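import Mathlib
import HarnessLib
import Summits.ValiantsHypothesis.ValiantsHypothesis.Theses.MonotoneRestoration
import Literature.Computability.AlgebraicComplexity.ArithCircuit
import Literature.Computability.AlgebraicComplexity.ArithCircuitProofs
import Literature.Computability.AlgebraicComplexity.MonotoneStructure
import Literature.Computability.AlgebraicComplexity.PermanentIrreducible
import Literature.ModelTheory.FiniteModelTheory.CkEquiv
import Summits.ValiantsHypothesis.ValiantsHypothesis.Theorems.MonotoneRestorationMonotoneRestorationQPCosetCount
import Summits.ValiantsHypothesis.ValiantsHypothesis.Theorems.MonotoneRestorationMonotoneRestorationQPSymmetricLB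
import Summits.ValiantsHypothesis.ValiantsHypothesis.Theorems.MonotoneRestorationMonotoneRestorationQPSupportSymmetrisation
import Summits.ValiantsHypothesis.ValiantsHypothesis.Theorems.MonotoneRestorationMonotoneRestorationQPSparseRegime
import Summits.ValiantsHypothesis.ValiantsHypothesis.Theorems.MonotoneRestorationMonotoneRestorationQPBeta
import Literature.Computability.AlgebraicComplexity.SymmetricArithCircuit
import Literature.Computability.AlgebraicComplexity.DawarWilsenach2025Proofs
import Literature.GroupTheory.PermutationGroups.SmallIndexSubgroups
import Summits.ValiantsHypothesis.ValiantsHypothesis.Theorems.MonotoneRestorationQP.Negative.LoadBearing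
import Summits.ValiantsHypothesis.ValiantsHypothesis.Theorems.MonotoneRestorationMonotoneRestorationQPPermSupportCount

/-! TTRL-lite variant V19905 of stmt-ValiantsHypothesis-15886 -/

-- `Summit.ValiantsHypothesis.ValiantsHypothesis.…` is the tree's mandated single-conjunct layout
-- (Sub = Summit), so the duplicated namespace component is intended.
set_option linter.dupNamespace false

namespace Summit.ValiantsHypothesis.ValiantsHypothesis.Theorems

open Summit.ValiantsHypothesis.ValiantsHypothesis.Theses.MonotoneRestoration
open Literature.Computability.AlgebraicComplexity

/-- TTRL-lite variant V19905 of `stmt-ValiantsHypothesis-15886` (stub `mulgate_children`):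
pure transitivity of shift-embeddings of exponent sets. If `A` shifts into `B` by `m₀` and
`B` shifts into `F` by `μ`, then `A` shifts into `F` by `m₀ + μ`. -/
theorem mulgate_children_var19905 :
    ∀ (n : ℕ) (A B F : Finset ((Fin n × Fin n) →₀ ℕ)),
      (∃ m₀ : (Fin n × Fin n) →₀ ℕ, ∀ m ∈ A, m + m₀ ∈ B) →
      (∃ μ : (Fin n × Fin n) →₀ ℕ, ∀ m ∈ B, m + μ ∈ F) →
      ∃ μ : (Fin n × Fin n) →₀ ℕ, ∀ m ∈ A, m + μ ∈ F := by
  intro n A B F hAB hBF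
  obtain ⟨m₀, hm₀⟩ := hAB
  obtain ⟨μ, hμ⟩ := hBF
  refine ⟨m₀ + μ, fun m hm => ?_⟩
  rw [← add_assoc]
  exact hμ (m + m₀) (hm₀ m hm)

end Summit.ValiantsHypothesis.ValiantsHypothesis.Theorems
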